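import Literature.Geometry.Kaehler.ComplexTorusHodgeDecomposition
import Literature.Geometry.Kaehler.ComplexTorusOfComplexStructure
import Mathlib.LinearAlgebra.Dual.Lemmas
import HarnessLib

/-!
# Holomorphic one-forms of a complex torus: `H^{1,0}(E/Λ) = Hom_ℂ(E, ℂ)`

Lange–Birkenhake, *Complex Abelian Varieties*, §1.1.5, Thm. 1.1.21 in bidegree `(1, 0)`: for the
complex torus `X = E/Φ(ℤ^ι)` (`ComplexTorus Φ`), the space `H^{1,0}(X)` — the tree's
`hodgePQ E X 1 1 0 ⊆ H¹_dR(X; ℂ)`, the span of the classes of closed `(1,0)`-forms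
(`Literature/NumberTheory/Transcendental/ComplexForms.lean`) — is exactly the space of classes of
the translation-invariant `ℂ`-LINEAR one-forms, `H^{1,0}(X) ≅ Ω := Hom_ℂ(V, ℂ)`
("`H^{p,q}(X) ≅ ⋀ᵖΩ ⊗ ⋀^qΩ̄`", `IF^{1,0}(X) = Ω`), hence `dim_ℂ H^{1,0}(X) = dim_ℂ E = g`. This is
the bidegree-`(1,0)` case of the torus Hodge decomposition PROVED in
`Literature/Geometry/Kaehler/ComplexTorusHodgeDecomposition.lean`
(`ComplexTorus.hodgePQ_eq_map_typeSubmodule`: `H^{p,q}(X) = cconstClass Φ (Λ^{p,q})`), combined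
with the pointwise statement "a one-form has type `(1,0)` iff it is `ℂ`-linear"
(`Literature/Analysis/Complex/PQTypes`: forms of type `(k,0)` are the `ℂ`-multilinear ones,
Huybrechts Prop. 1.2.8):

* `oneForm : (E →L[ℝ] ℂ) ≃ₗ[ℂ] (E [⋀^Fin 1]→L[ℝ] ℂ)` — real functionals as constant one-forms;
  `isOfTypeAt_one_zero_iff`: `oneForm ℓ` has type `(1,0)` iff `ℓ` is `ℂ`-linear;
* `typeOneZeroEquiv : (E →L[ℂ] ℂ) ≃ₗ[ℂ] Λ^{1,0}` (`typeSubmodule E 1 1 0`);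
* **`ComplexTorus.mem_hodgePQ_one_zero_iff`**: a class lies in `H^{1,0}(X)` iff it is the class
  `cconstClass Φ (oneForm ℓ)` of a `ℂ`-linear functional `ℓ : E →L[ℂ] ℂ` (unique,
  `cconstClass_oneForm_injective`), and **`ComplexTorus.finrank_hodgePQ_one_zero`**:
  `dim_ℂ H^{1,0}(X) = dim_ℂ E`.

For the complex torus `(W, J)/Λ` of a complex structure (`CxModule.periodIso`,
`ComplexTorusOfComplexStructure`): `CxModule.isComplexLinear_comp_coordJ_symm_iff` — a real
functional `ℓ₀ : W → ℂ` read in the complex coordinates `coordJ` is `ℂ`-linear iff it is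
`J`-holomorphic, `ℓ₀ ∘ J = i ℓ₀`; so `H^{1,0}((W, J)/Λ)` is the space of `J`-holomorphic
functionals on `W` (Deligne, LNM 900, p. 50: the `+i`-eigenspace of `J` is `H^{-1,0}`, i.e. the
holomorphic differentials are the functionals of type `(1,0)` for `J`).

Everything is proved; no named fact is introduced. Not here: `H^{0,1}` (the conjugate statement)
and higher bidegrees `⋀ᵖΩ ⊗ ⋀^qΩ̄`.

## References

* [LangeBirkenhake1992] H. Lange, Ch. Birkenhake, *Complex Abelian Varieties* (1992), §1.1.5
  Thm. 1.1.21, Prop. 1.1.23.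
* [HuybrechtsCG2005] D. Huybrechts, *Complex Geometry* (2005), Prop. 1.2.8.
* [Deligne1982HodgeCycles] P. Deligne, LNM 900 (1982), proof of Thm. 4.8, p. 50.
-/

noncomputable section

open Module
open scoped Manifold

namespace Literature.Geometry.Kaehler

open Literature.Analysis.Complex Literature.NumberTheory.Transcendental

universe u

/-! ### Constant one-forms and their type -/

section OneForm

variable {E : Type*} [NormedAddCommGroup E] [NormedSpace ℂ E]

/-- **Real functionals as constant one-forms**: `ℓ ↦ (v ↦ ℓ(v₀))`, a `ℂ`-linear isomorphism
`(E →L[ℝ] ℂ) ≃ Alt¹_ℝ(E; ℂ)` (Mathlib's `ContinuousAlternatingMap.ofSubsingleton`, made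
`ℂ`-linear for the pointwise complex structures). [folklore] -/
def oneForm : (E →L[ℝ] ℂ) ≃ₗ[ℂ] (E [⋀^Fin 1]→L[ℝ] ℂ) where
  toFun ℓ := ContinuousAlternatingMap.ofSubsingleton ℝ E ℂ (0 : Fin 1) ℓ
  invFun ω := (ContinuousAlternatingMap.ofSubsingleton ℝ E ℂ (0 : Fin 1)).symm ω
  map_add' _ _ := by ext; simp
  map_smul' _ _ := by ext; simp
  left_inv := (ContinuousAlternatingMap.ofSubsingleton ℝ E ℂ (0 : Fin 1)).left_inv
  right_inv := (ContinuousAlternatingMap.ofSubsingleton ℝ E ℂ (0 : Fin 1)).right_inv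

/-- `oneForm ℓ v = ℓ (v 0)`. [folklore] -/
@[simp]
theorem oneForm_apply (ℓ : E →L[ℝ] ℂ) (v : Fin 1 → E) : oneForm ℓ v = ℓ (v 0) := rfl

/-- `oneForm.symm ω u = ω (fun _ ↦ u)`. [folklore] -/
@[simp]
theorem oneForm_symm_apply (ω : E [⋀^Fin 1]→L[ℝ] ℂ) (u : E) :
    oneForm.symm ω u = ω fun _ => u := by
  simp [oneForm]

/-- **A constant one-form has type `(1,0)` iff its functional is `ℂ`-linear** (forms of type
`(k,0)` are the `ℂ`-multilinear ones, Huybrechts Prop. 1.2.8; tree: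
`isOfTypeAt_of_forall_update_smul`, `IsOfTypeAt.map_update_smul`). [cite: HuybrechtsCG2005, Prop. 1.2.8] -/
theorem isOfTypeAt_one_zero_iff (ℓ : E →L[ℝ] ℂ) :
    IsOfTypeAt 1 0 (oneForm ℓ) ↔ ∀ (c : ℂ) (v : E), ℓ (c • v) = c * ℓ v := by
  constructor
  · intro h c v
    have h1 := h.map_update_smul (fun _ => v) 0 c
    simpa using h1
  · intro h
    refine isOfTypeAt_of_forall_update_smul fun v j c => ?_
    obtain rfl : j = 0 := Subsingleton.elim _ _
    simp [h]

/-- A `ℂ`-linear functional, as a constant one-form, lies in `Λ^{1,0}`. [cite: HuybrechtsCG2005, Prop. 1.2.8] -/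
theorem oneForm_restrictScalars_mem (ℓ : E →L[ℂ] ℂ) :
    oneForm (ℓ.restrictScalars ℝ) ∈ typeSubmodule E 1 1 0 :=
  ((isOfTypeAt_one_zero_iff _).2 fun c v => by simp).mem_typeSubmodule

/-- The functional of a form in `Λ^{1,0}` commutes with `i`. [folklore] -/
theorem oneForm_symm_I_smul (ω : typeSubmodule E 1 1 0) (u : E) :
    oneForm.symm ω.1 (Complex.I • u) = Complex.I • oneForm.symm ω.1 u := by
  have hω : IsOfTypeAt 1 0 (oneForm (oneForm.symm ω.1)) := by
    rw [LinearEquiv.apply_symm_apply]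
    exact isOfTypeAt_of_mem_typeSubmodule rfl ω.2
  rw [smul_eq_mul]
  exact (isOfTypeAt_one_zero_iff _).1 hω Complex.I u

/-- **`Λ^{1,0} = Hom_ℂ(E, ℂ)`**: the `ℂ`-linear functionals are exactly the constant one-forms of
type `(1,0)` (`IF^{1,0} = Ω`, Lange–Birkenhake §1.1.5). [cite: LangeBirkenhake1992, §1.1.5 Thm. 1.1.21] -/
def typeOneZeroEquiv : (E →L[ℂ] ℂ) ≃ₗ[ℂ] typeSubmodule E 1 1 0 where
  toFun ℓ := ⟨oneForm (ℓ.restrictScalars ℝ), oneForm_restrictScalars_mem ℓ⟩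
  invFun ω := toComplexLinear (oneForm.symm ω.1) (oneForm_symm_I_smul ω)
  map_add' ℓ ℓ' := Subtype.ext (by simp)
  map_smul' c ℓ := Subtype.ext (by simp)
  left_inv ℓ := by ext u; simp
  right_inv ω := by
    apply Subtype.ext
    change oneForm ((toComplexLinear (oneForm.symm ω.1) (oneForm_symm_I_smul ω)).restrictScalars ℝ) = ω.1
    conv_rhs => rw [← oneForm.apply_symm_apply ω.1]
    rfl

/-- `typeOneZeroEquiv ℓ = oneForm ℓ` as forms. [folklore] -/
@[simp]
theorem coe_typeOneZeroEquiv (ℓ : E →L[ℂ] ℂ) :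
    (typeOneZeroEquiv ℓ : E [⋀^Fin 1]→L[ℝ] ℂ) = oneForm (ℓ.restrictScalars ℝ) := rfl

end OneForm

/-! ### `H^{1,0}` of a complex torus -/

namespace ComplexTorus

variable {ι : Type*} [Fintype ι] {E : Type*} [NormedAddCommGroup E] [NormedSpace ℂ E]
  (Φ : (ι → ℝ) ≃L[ℝ] E) [FiniteDimensional ℂ E]

/-- **`H^{1,0}(X)` consists of the classes of the invariant `ℂ`-linear one-forms** (Lange–Birkenhake
Thm. 1.1.21 / Prop. 1.1.23 in bidegree `(1,0)`: `H^{1,0}(X) ≅ IF^{1,0}(X) = Ω = Hom_ℂ(V, ℂ)`).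
[cite: LangeBirkenhake1992, §1.1.5 Thm. 1.1.21] -/
theorem mem_hodgePQ_one_zero_iff (x : complexDeRhamCohomology E (ComplexTorus Φ) 1) :
    x ∈ hodgePQ E (ComplexTorus Φ) 1 1 0 ↔
      ∃ ℓ : E →L[ℂ] ℂ, cconstClass Φ (oneForm (ℓ.restrictScalars ℝ)) = x := by
  rw [hodgePQ_eq_map_typeSubmodule, Submodule.mem_map]
  constructor
  · rintro ⟨ω, hω, rfl⟩
    refine ⟨typeOneZeroEquiv.symm ⟨ω, hω⟩, ?_⟩
    rw [← coe_typeOneZeroEquiv, LinearEquiv.apply_symm_apply]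
  · rintro ⟨ℓ, rfl⟩
    exact ⟨_, oneForm_restrictScalars_mem ℓ, rfl⟩

/-- The class of the invariant one-form of a `ℂ`-linear functional lies in `H^{1,0}(X)`.
[cite: LangeBirkenhake1992, §1.1.5 Thm. 1.1.21] -/
theorem cconstClass_oneForm_mem_hodgePQ (ℓ : E →L[ℂ] ℂ) :
    cconstClass Φ (oneForm (ℓ.restrictScalars ℝ)) ∈ hodgePQ E (ComplexTorus Φ) 1 1 0 :=
  (mem_hodgePQ_one_zero_iff Φ _).2 ⟨ℓ, rfl⟩

/-- **Distinct functionals give distinct classes** (every class has a unique invariant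
representative, Lange–Birkenhake Prop. 1.1.20: `cconstClassEquiv`). [cite: LangeBirkenhake1992, Prop. 1.1.20] -/
theorem cconstClass_oneForm_injective :
    Function.Injective fun ℓ : E →L[ℂ] ℂ => cconstClass Φ (oneForm (ℓ.restrictScalars ℝ)) := by
  intro ℓ ℓ' h
  have h1 : oneForm (ℓ.restrictScalars ℝ) = oneForm (ℓ'.restrictScalars ℝ) := by
    apply (cconstClassEquiv Φ (k := 1)).injective
    simpa using h
  apply typeOneZeroEquiv.injective
  exact Subtype.ext (by rw [coe_typeOneZeroEquiv, coe_typeOneZeroEquiv, h1])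

/-- **`dim_ℂ H^{1,0}(X) = dim_ℂ E`** (`= g`, the dimension of the torus; Lange–Birkenhake
Thm. 1.1.21: `H^{1,0}(X) ≅ Ω`, `dim Ω = g`). [cite: LangeBirkenhake1992, §1.1.5 Thm. 1.1.21] -/
theorem finrank_hodgePQ_one_zero :
    finrank ℂ (hodgePQ E (ComplexTorus Φ) 1 1 0) = finrank ℂ E := by
  rw [hodgePQ_eq_map_typeSubmodule, ← coe_cconstClassEquiv, LinearEquiv.finrank_map_eq,
    ← typeOneZeroEquiv.finrank_eq,
    (LinearMap.toContinuousLinearMap : (E →ₗ[ℂ] ℂ) ≃ₗ[ℂ] (E →L[ℂ] ℂ)).symm.finrank_eq]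
  exact Subspace.dual_finrank_eq

end ComplexTorus

/-! ### The torus of a complex structure: holomorphic differentials are the `J`-holomorphic functionals -/

namespace CxModule

variable {W : Type u} [AddCommGroup W] [Module ℝ W] [Module.Finite ℝ W]
  (J : W →ₗ[ℝ] W) (hJ : J * J = -1) {n : ℕ} (hn : finrank ℝ W = 2 * n)

/-- **In complex coordinates, `ℂ`-linear = `J`-holomorphic.** A real functional `ℓ₀ : W → ℂ`,
read on `ℂⁿ` through the complex coordinates `coordJ` of `(W, J)`, is `ℂ`-linear iff
`ℓ₀(Jw) = i ℓ₀(w)` for all `w` (`coordJ` carries `J` to `i`, `coordJ_symm_I_smul`). Hence, by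
`ComplexTorus.mem_hodgePQ_one_zero_iff`, the holomorphic differentials `H^{1,0}` of the torus
`(W, J)/Λ` (`periodIso`) are the `J`-holomorphic functionals on `W` (Deligne, LNM 900, p. 50: for
the complex structure `J` the eigenspace `H_τ⁺` is `H^{-1,0}`).
[cite: Deligne1982HodgeCycles, proof of Thm. 4.8, p. 50] -/
theorem isComplexLinear_comp_coordJ_symm_iff (ℓ₀ : W →ₗ[ℝ] ℂ) :
    (∀ (c : ℂ) (u : Fin n → ℂ),
        ℓ₀ ((coordJ J hJ hn).symm (c • u)) = c * ℓ₀ ((coordJ J hJ hn).symm u)) ↔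
      ∀ w, ℓ₀ (J w) = Complex.I * ℓ₀ w := by
  constructor
  · intro h w
    have h1 := h Complex.I (coordJ J hJ hn w)
    rwa [coordJ_symm_I_smul, LinearEquiv.symm_apply_apply] at h1
  · intro h c u
    set w := (coordJ J hJ hn).symm u with hw
    have hu : u = coordJ J hJ hn w := by rw [hw, LinearEquiv.apply_symm_apply]
    have hreal : ∀ (r : ℝ) (v : Fin n → ℂ), (r : ℂ) • v = r • v := fun r v => by
      ext i; simp [Complex.real_smul]
    have hc : c • u = coordJ J hJ hn ((c.re : ℝ) • w + (c.im : ℝ) • J w) := by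
      rw [map_add, LinearEquiv.map_smul, LinearEquiv.map_smul, coordJ_J, ← hu, ← hreal, ← hreal,
        ← mul_smul, ← add_smul, Complex.re_add_im]
    rw [hc, LinearEquiv.symm_apply_apply, map_add, LinearMap.map_smul, LinearMap.map_smul, h w,
      Complex.real_smul, Complex.real_smul, ← mul_assoc, ← add_mul, Complex.re_add_im]

end CxModule

end Literature.Geometry.Kaehler
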